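/-
Copyright (c) 2026 the pub-hodgecm-mathlib formalisation cell (harness21).  Prover seat hodgecm-mathlib-K2Liu-p12 (g3): Track B «K2-LIT»,
#184♮ = hLiu418 = stmt-HodgeConjecture-24832; Road Φ of socket #41, Φ9 consumer sheet row G1 = organ Φ3d, the CLOSING file (K2E5-plan (g7) deal (b′) 2026-09-04T11:53:45Z;
(d3) ★ p860036, (d2) ★ p860108 (this seat), (d1) ★ p860111 (K2E5-p17 (g7))).
-/
import Summits.HodgeConjecture.HodgeConjecture.Theorems.K2LiuWhittakerDeltaIntegrandFactorisation   -- ★ (d2) row G1 for factorizable families, `hψ`∕`hψK` by value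
import Summits.HodgeConjecture.HodgeConjecture.Theorems.K2LiuSiegelUnipotentCharacterFactorisation   -- ★ (d1) `conj_unipDeltaChar_eq_mul_finprod_off`, `unipDeltaChar_locToAdelic_eq_one_of_integral`
import HarnessLib

/-!
# Crux `HLiu418`, Road Φ of socket #41, organ Φ3d — ROW G1's HEAD WITH ALL CHARACTER LETTERS ★:
# `W_S(f_s)(h) = W_{S,T}(s)(h_∞, h_T) · ∏'_{v∉T} W°_{S,v}(s)`, `W°_{S,v}(s) = ∫_{N_Δ(L⁺_v)} conj ψ_S(ι_v y) · Λ_{s,v}(w_Δ y) dν_v(y)`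

Cell `hodgecm-mathlib`, crux item hLiu418 = `stmt-HodgeConjecture-24832`, route of record `HCCMUnconditional`; squad K2 ∕ K2Liu, road `K2_Liu`,
socket #41 `sig_K2LiuSiegelEisensteinContinuation`, Road Φ; Φ9 consumer sheet row G1 (face «`whittakerDelta νN S (f s) h = W_{S,T}(s)(h_∞,h_T) ·
∏'_{v∉T} W°_{S,v}(s)(h_v)` on `re s > n∕2`, `T ⊇ T₀(𝒦,f,h_f)` finite, spherical local factors off `T`»).  THEOREMS ONLY (no `def`, no `instance`, no
`notation`, no named-fact hypothesis, no `sorry`); lane `--supports stmt-HodgeConjecture-24832` (count-neutral helper; closes no socket by itself).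

THE MATHEMATICS.  ★ (d2) `whittakerDelta_eq_mul_tprod_of_isFactorizableOff` is row G1's head for a family `f` factorizable off `T` (★ #31s) with the unipotent
character factorised place by place BY VALUE (`hψ`, `hψK`).  ★ (d1) (K2E5-p17) discharges both letters DEFINITION-FREE — `ψ_{S,v} := ψ_S ∘ ι_v`,
`ψ_{S,∞} := ψ_S ∘ (·, 1)`: `conj_unipDeltaChar_eq_mul_finprod_off` (Tate's product formula for `ψ_S`, split along `T`) and `unipDeltaChar_locToAdelic_eq_one_of_integral`
(`ψ_S(ι_v k) = 1` on `K_{H,v} ∩ N_Δ(L⁺_v)` wherever the entries of `S` are integral above `v`).  Substituting: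
* **`whittakerDelta_eq_mul_tprod_euler`** — for Φ3c's measure letters, `χ` unramified off `T`, `IsFactorizableOff T χ f fT`, `h_v, w_{Δ,v} ∈ K_{H,v}` off `T`, the entries of `S`
  integral above every `v ∉ T` (`hS`; ★ (d1) `exists_finset_forall_integral` gives the finite exceptional set `T₀(S)`), and `G ∈ L¹(νN)` (★ O41.3):
  `W_S(f_s)(h) = (∫ [conj ψ_S(p_∞,1) ∏_{v∈T} conj ψ_S(ι_v p_v)] · fT_s(w_Δ p_∞ h_∞, (w_Δ p_v h_v)_T) d(ν_∞ ⊗ ⊗_{v∈T} ν_v)) · ∏'_{v∉T} ∫_{N_Δ(L⁺_v)} conj ψ_S(ι_v y) · Λ_{s,v}(w_Δ y) dν_v(y)`,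
  together with the integrability of the transported integrand — every letter of row G1 except the analytic inputs (measures, `hfac`, `hh`, `hw`, `hS`, `hG`) is ★.
The local factor off `T` is the spherical local Whittaker coefficient `W°_{S,v}(s)` (its unimodular good-place VALUE ★ E5∕E7 `K2LiuGoodPlaceWhittakerUnimodularValue{,CM}`,
its Euler product over the good places ★ `K2LiuGoodPlaceWhittakerEulerAssembly`).
HONEST LABEL.  Count-neutral helper; it retires nothing by itself: `HC_CM` is proved only modulo the 7 printed citations (2 remaining named inputs:
hLiu418 = `stmt-HodgeConjecture-24832`, h413 = `stmt-HodgeConjecture-24833`) until rung 0 closes.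

## References
* [KudlaRallis1994] S. Kudla, S. Rallis, Ann. of Math. 140 (1994): §1–§2.   * [Tan1999] V. Tan, Canad. J. Math. 51 (1999): §2–§3 (`W_β = ⊗_v W_{β,v}`).
* [CasselsFrohlichANT1967] Cassels–Fröhlich (eds.), *Algebraic Number Theory* (1967): Ch. XV (Tate) Lemma 3.2.1, Thm. 3.3.1.
* [Shimura1997] G. Shimura, CBMS 93 (1997): §18.3.   * [Liu2011] Y. Liu, Algebra Number Theory 5 (2011): §2B–§2C.
-/

set_option autoImplicit false
-- the mandated namespace repeats the single-problem summit's segment (`HodgeConjecture.HodgeConjecture`)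
set_option linter.dupNamespace false

noncomputable section

open scoped Matrix RestrictedProduct ENNReal NNReal Topology ComplexConjugate
open NumberField IsDedekindDomain MeasureTheory Measure Filter Set

namespace Summit.HodgeConjecture.HodgeConjecture.Cruxes.HLiu418.K2LiuWhittakerDeltaEulerProduct

open Literature.NumberTheory.Automorphic Literature.NumberTheory.GaloisRepresentations
open Literature.NumberTheory.GelbartRogawski1991 Literature.NumberTheory.GelbartRogawski1991.GRConstruction
open Literature.NumberTheory.K2Lit.SiegelDoubled
open Literature.NumberTheory.K2Lit.PlaceSplitting
open Literature.MeasureTheory.RestrictedProduct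
open Literature.Topology.Algebra.RestrictedProduct (inH)
open Summit.HodgeConjecture.HodgeConjecture.Cruxes.HLiu418.K2LiuSiegelUnipotentLocalDefs
open Summit.HodgeConjecture.HodgeConjecture.Cruxes.HLiu418.K2LiuSiegelUnipotentSplitDefs
open Summit.HodgeConjecture.HodgeConjecture.Cruxes.HLiu418.K2LiuSiegelUnipotentSplitAtDefs
open Summit.HodgeConjecture.HodgeConjecture.Cruxes.HLiu418.K2LiuSiegelUnipotentHaarPinned
open Summit.HodgeConjecture.HodgeConjecture.Cruxes.HLiu418.K2LiuSiegelUnipotentEulerProduct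
open Summit.HodgeConjecture.HodgeConjecture.Cruxes.HLiu418.K2LiuSiegelUnipotentFourierDefs
open Summit.HodgeConjecture.HodgeConjecture.Cruxes.HLiu418.K2LiuWhittakerDeltaEulerHead
open Summit.HodgeConjecture.HodgeConjecture.Cruxes.HLiu418.K2LiuWhittakerDeltaIntegrandFactorisation
open Summit.HodgeConjecture.HodgeConjecture.Cruxes.HLiu418.K2LiuSiegelUnipotentCharacterFactorisation

variable (L : Type) [Field L] [NumberField L] [IsCMField L]
variable {N M n : ℕ} (e : Fin N × Fin M ≃ Fin n)
  (dV : Fin N → L) (hdV : ∀ i, IsCMField.complexConj L (dV i) = dV i)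
  (dW : Fin M → L) (hdW : ∀ i, IsCMField.complexConj L (dW i) = dW i)
  (T : Finset (HeightOneSpectrum (𝓞 (Fp L)))) [DecidableEq (HeightOneSpectrum (𝓞 (Fp L)))]
  [MeasurableSpace ↥(unipDelta L e dV hdV dW hdW)] [BorelSpace ↥(unipDelta L e dV hdV dW hdW)]
  [MeasurableSpace ↥(unipDeltaArch L e dV hdV dW hdW)] [BorelSpace ↥(unipDeltaArch L e dV hdV dW hdW)]
  [∀ v : HeightOneSpectrum (𝓞 (Fp L)), MeasurableSpace ↥(unipDeltaLoc L e dV hdV dW hdW v)] [∀ v : HeightOneSpectrum (𝓞 (Fp L)), BorelSpace ↥(unipDeltaLoc L e dV hdV dW hdW v)]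

set_option maxHeartbeats 800000 in -- MEASURED (as ★ (d2) `whittakerDelta_eq_mul_tprod_of_isFactorizableOff`: > 400 000): the adelic doubled unitary datum + the Haar∕Borel tower; plain `exact`
/-- **ROW G1's EULER HEAD, CHARACTER LETTERS DISCHARGED.**  Φ3c's measure letters verbatim; `χ` unramified off `T`; `f` factorizable off `T` (★ #31s `IsFactorizableOff T χ f fT`);
`h_v, w_{Δ,v} ∈ K_{H,v}` off `T`; the entries of `S` integral above every `v ∉ T` (`hS`, ★ `exists_finset_forall_integral`); `G ∈ L¹(νN)` (★ O41.3).  Then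
`W_S(f_s)(h) = (∫ [conj ψ_S(p_∞,1)·∏_{v∈T} conj ψ_S(ι_v p_v)]·fT_s(w_Δ p_∞ h_∞, (w_Δ p_v h_v)_{v∈T}) d(ν_∞ ⊗ ⊗_{v∈T} ν_v)) · ∏'_{v∉T} ∫_{N_Δ(L⁺_v)} conj ψ_S(ι_v y)·Λ_{s,v}(w_Δ y) dν_v(y)`
(+ integrability of the transported integrand): ★ (d2) with `hψ` := ★ (d1) `conj_unipDeltaChar_eq_mul_finprod_off`, `hψK` := ★ (d1) `unipDeltaChar_locToAdelic_eq_one_of_integral`.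
[cite: KudlaRallis1994, §1–§2] [cite: Tan1999, §2–§3] [cite: CasselsFrohlichANT1967, Ch. XV Lemma 3.2.1, Thm. 3.3.1] -/
theorem whittakerDelta_eq_mul_tprod_euler
    (νN : Measure ↥(unipDelta L e dV hdV dW hdW)) (νv : ∀ v : HeightOneSpectrum (𝓞 (Fp L)), Measure ↥(unipDeltaLoc L e dV hdV dW hdW v)) [∀ v, (νv v).IsHaarMeasure]
    [∀ v, SigmaFinite (νv v)]
    (hνK : ∀ v, v ∉ T → νv v (((inH (fun v => UnitaryGroup.localInt L (IsCMField.complexConj L) (n + n) (hermD L e dV hdV dW hdW) v) (fun v => unipDeltaLoc L e dV hdV dW hdW v) v) : Subgroup ↥(unipDeltaLoc L e dV hdV dW hdW v)) : Set ↥(unipDeltaLoc L e dV hdV dW hdW v)) = 1)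
    (νinf : Measure ↥(unipDeltaArch L e dV hdV dW hdW)) [SigmaFinite νinf]
    (hmap : Measure.map (unipDeltaSplitAt L e dV hdV dW hdW T) νN =
      νinf.prod ((Measure.pi fun v : T => νv v.1).prod
        (rpMeasure (fun v : {v : HeightOneSpectrum (𝓞 (Fp L)) // v ∉ T} => ((inH (fun v => UnitaryGroup.localInt L (IsCMField.complexConj L) (n + n) (hermD L e dV hdV dW hdW) v) (fun v => unipDeltaLoc L e dV hdV dW hdW v) v.1 : Subgroup ↥(unipDeltaLoc L e dV hdV dW hdW v.1)) : Set ↥(unipDeltaLoc L e dV hdV dW hdW v.1))) (fun v => νv v.1) ∅)))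
    {χ : HeckeCharacter L} (hχ : ∀ v, v ∉ T → ∀ w' : UnitaryGroup.PlacesOver L v, χ.IsUnramifiedAt w'.1)
    {f : ℂ → HA L e dV hdV dW hdW → ℂ}
    {fT : ℂ → UnitaryGroup.arch (Fp L) L (IsCMField.complexConj L) (n + n) (hermD L e dV hdV dW hdW) ×
      (Π v : T, UnitaryGroup.localPi L (IsCMField.complexConj L) (n + n) (hermD L e dV hdV dW hdW) v.1) → ℂ}
    (hfac : IsFactorizableOff L e dV hdV dW hdW T χ f fT) (s : ℂ) (S : Matrix (Fin n) (Fin n) L) {h : HA L e dV hdV dW hdW}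
    (hh : ∀ v, v ∉ T → UnitaryGroup.evalPlace (Fp L) L (IsCMField.complexConj L) (n + n) (hermD L e dV hdV dW hdW) v
      (UnitaryGroup.finPart (Fp L) L (IsCMField.complexConj L) (n + n) (hermD L e dV hdV dW hdW) h) ∈
        UnitaryGroup.localInt L (IsCMField.complexConj L) (n + n) (hermD L e dV hdV dW hdW) v)
    (hw : ∀ v, v ∉ T → UnitaryGroup.evalPlace (Fp L) L (IsCMField.complexConj L) (n + n) (hermD L e dV hdV dW hdW) v
      (UnitaryGroup.finPart (Fp L) L (IsCMField.complexConj L) (n + n) (hermD L e dV hdV dW hdW) (weylDelta L e dV hdV dW hdW)) ∈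
        UnitaryGroup.localInt L (IsCMField.complexConj L) (n + n) (hermD L e dV hdV dW hdW) v)
    (hS : ∀ v, v ∉ T → ∀ (w : UnitaryGroup.PlacesOver L v) (i j : Fin n), ((S i j : L) : w.1.adicCompletion L) ∈ w.1.adicCompletionIntegers L)
    (hG : Integrable (fun u : ↥(unipDelta L e dV hdV dW hdW) =>
      conj (unipDeltaChar L e dV hdV dW hdW S (u : HA L e dV hdV dW hdW) : ℂ) * f s (weylDelta L e dV hdV dW hdW * (u : HA L e dV hdV dW hdW) * h)) νN) :
    Integrable (fun z : (↥(unipDeltaArch L e dV hdV dW hdW) × (Π v : T, ↥(unipDeltaLoc L e dV hdV dW hdW v.1))) × (Πʳ v : {v : HeightOneSpectrum (𝓞 (Fp L)) // v ∉ T}, [↥(unipDeltaLoc L e dV hdV dW hdW v.1), inH (fun v => UnitaryGroup.localInt L (IsCMField.complexConj L) (n + n) (hermD L e dV hdV dW hdW) v) (fun v => unipDeltaLoc L e dV hdV dW hdW v) v.1]) =>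
        ((conj (unipDeltaChar L e dV hdV dW hdW S
              (UnitaryGroup.archToAdelic (Fp L) L (IsCMField.complexConj L) (n + n) (hermD L e dV hdV dW hdW)
                (z.1.1 : UnitaryGroup.arch (Fp L) L (IsCMField.complexConj L) (n + n) (hermD L e dV hdV dW hdW))) : ℂ) *
            ∏ v : T, conj (unipDeltaChar L e dV hdV dW hdW S
              (locToAdelic L e dV hdV dW hdW v.1
                ((z.1.2 v : ↥(unipDeltaLoc L e dV hdV dW hdW v.1)) : UnitaryGroup.localPi L (IsCMField.complexConj L) (n + n) (hermD L e dV hdV dW hdW) v.1)) : ℂ)) *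
            fT s (UnitaryGroup.archPart (Fp L) L (IsCMField.complexConj L) (n + n) (hermD L e dV hdV dW hdW) (weylDelta L e dV hdV dW hdW) *
                  (z.1.1 : UnitaryGroup.arch (Fp L) L (IsCMField.complexConj L) (n + n) (hermD L e dV hdV dW hdW)) *
                  UnitaryGroup.archPart (Fp L) L (IsCMField.complexConj L) (n + n) (hermD L e dV hdV dW hdW) h,
                fun v : T => UnitaryGroup.evalPlace (Fp L) L (IsCMField.complexConj L) (n + n) (hermD L e dV hdV dW hdW) v.1
                    (UnitaryGroup.finPart (Fp L) L (IsCMField.complexConj L) (n + n) (hermD L e dV hdV dW hdW) (weylDelta L e dV hdV dW hdW)) *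
                  ((z.1.2 v : ↥(unipDeltaLoc L e dV hdV dW hdW v.1)) : UnitaryGroup.localPi L (IsCMField.complexConj L) (n + n) (hermD L e dV hdV dW hdW) v.1) *
                  UnitaryGroup.evalPlace (Fp L) L (IsCMField.complexConj L) (n + n) (hermD L e dV hdV dW hdW) v.1
                    (UnitaryGroup.finPart (Fp L) L (IsCMField.complexConj L) (n + n) (hermD L e dV hdV dW hdW) h))) *
          ∏ᶠ v : {v : HeightOneSpectrum (𝓞 (Fp L)) // v ∉ T},
            conj (unipDeltaChar L e dV hdV dW hdW S
              (locToAdelic L e dV hdV dW hdW v.1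
                ((z.2 v : ↥(unipDeltaLoc L e dV hdV dW hdW v.1)) : UnitaryGroup.localPi L (IsCMField.complexConj L) (n + n) (hermD L e dV hdV dW hdW) v.1)) : ℂ) *
              LambdaLoc L e dV hdV dW hdW v.1 χ s
                (UnitaryGroup.evalPlace (Fp L) L (IsCMField.complexConj L) (n + n) (hermD L e dV hdV dW hdW) v.1
                    (UnitaryGroup.finPart (Fp L) L (IsCMField.complexConj L) (n + n) (hermD L e dV hdV dW hdW) (weylDelta L e dV hdV dW hdW)) *
                  ((z.2 v : ↥(unipDeltaLoc L e dV hdV dW hdW v.1)) : UnitaryGroup.localPi L (IsCMField.complexConj L) (n + n) (hermD L e dV hdV dW hdW) v.1)))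
      ((νinf.prod (Measure.pi fun v : T => νv v.1)).prod (rpMeasure (fun v : {v : HeightOneSpectrum (𝓞 (Fp L)) // v ∉ T} => ((inH (fun v => UnitaryGroup.localInt L (IsCMField.complexConj L) (n + n) (hermD L e dV hdV dW hdW) v) (fun v => unipDeltaLoc L e dV hdV dW hdW v) v.1 : Subgroup ↥(unipDeltaLoc L e dV hdV dW hdW v.1)) : Set ↥(unipDeltaLoc L e dV hdV dW hdW v.1))) (fun v => νv v.1) ∅)) ∧
    whittakerDelta L e dV hdV dW hdW νN S (f s) h =
      (∫ p, (conj (unipDeltaChar L e dV hdV dW hdW S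
              (UnitaryGroup.archToAdelic (Fp L) L (IsCMField.complexConj L) (n + n) (hermD L e dV hdV dW hdW)
                (p.1 : UnitaryGroup.arch (Fp L) L (IsCMField.complexConj L) (n + n) (hermD L e dV hdV dW hdW))) : ℂ) *
            ∏ v : T, conj (unipDeltaChar L e dV hdV dW hdW S
              (locToAdelic L e dV hdV dW hdW v.1
                ((p.2 v : ↥(unipDeltaLoc L e dV hdV dW hdW v.1)) : UnitaryGroup.localPi L (IsCMField.complexConj L) (n + n) (hermD L e dV hdV dW hdW) v.1)) : ℂ)) *
          fT s (UnitaryGroup.archPart (Fp L) L (IsCMField.complexConj L) (n + n) (hermD L e dV hdV dW hdW) (weylDelta L e dV hdV dW hdW) *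
                (p.1 : UnitaryGroup.arch (Fp L) L (IsCMField.complexConj L) (n + n) (hermD L e dV hdV dW hdW)) *
                UnitaryGroup.archPart (Fp L) L (IsCMField.complexConj L) (n + n) (hermD L e dV hdV dW hdW) h,
              fun v : T => UnitaryGroup.evalPlace (Fp L) L (IsCMField.complexConj L) (n + n) (hermD L e dV hdV dW hdW) v.1
                  (UnitaryGroup.finPart (Fp L) L (IsCMField.complexConj L) (n + n) (hermD L e dV hdV dW hdW) (weylDelta L e dV hdV dW hdW)) *
                ((p.2 v : ↥(unipDeltaLoc L e dV hdV dW hdW v.1)) : UnitaryGroup.localPi L (IsCMField.complexConj L) (n + n) (hermD L e dV hdV dW hdW) v.1) *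
                UnitaryGroup.evalPlace (Fp L) L (IsCMField.complexConj L) (n + n) (hermD L e dV hdV dW hdW) v.1
                  (UnitaryGroup.finPart (Fp L) L (IsCMField.complexConj L) (n + n) (hermD L e dV hdV dW hdW) h))
          ∂(νinf.prod (Measure.pi fun v : T => νv v.1))) *
        ∏' v : {v : HeightOneSpectrum (𝓞 (Fp L)) // v ∉ T},
          ∫ y, conj (unipDeltaChar L e dV hdV dW hdW S
              (locToAdelic L e dV hdV dW hdW v.1 (y : UnitaryGroup.localPi L (IsCMField.complexConj L) (n + n) (hermD L e dV hdV dW hdW) v.1)) : ℂ) *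
            LambdaLoc L e dV hdV dW hdW v.1 χ s
              (UnitaryGroup.evalPlace (Fp L) L (IsCMField.complexConj L) (n + n) (hermD L e dV hdV dW hdW) v.1
                  (UnitaryGroup.finPart (Fp L) L (IsCMField.complexConj L) (n + n) (hermD L e dV hdV dW hdW) (weylDelta L e dV hdV dW hdW)) *
                (y : UnitaryGroup.localPi L (IsCMField.complexConj L) (n + n) (hermD L e dV hdV dW hdW) v.1)) ∂(νv v.1) :=
  whittakerDelta_eq_mul_tprod_of_isFactorizableOff L e dV hdV dW hdW T νN νv hνK νinf hmap hχ hfac s S hh hw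
    (ΨT := fun p => (conj (unipDeltaChar L e dV hdV dW hdW S
        (UnitaryGroup.archToAdelic (Fp L) L (IsCMField.complexConj L) (n + n) (hermD L e dV hdV dW hdW)
          (p.1 : UnitaryGroup.arch (Fp L) L (IsCMField.complexConj L) (n + n) (hermD L e dV hdV dW hdW))) : ℂ) *
      ∏ v : T, conj (unipDeltaChar L e dV hdV dW hdW S
        (locToAdelic L e dV hdV dW hdW v.1
          ((p.2 v : ↥(unipDeltaLoc L e dV hdV dW hdW v.1)) : UnitaryGroup.localPi L (IsCMField.complexConj L) (n + n) (hermD L e dV hdV dW hdW) v.1)) : ℂ)))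
    (Ψv := fun v y => conj (unipDeltaChar L e dV hdV dW hdW S
      (locToAdelic L e dV hdV dW hdW v (y : UnitaryGroup.localPi L (IsCMField.complexConj L) (n + n) (hermD L e dV hdV dW hdW) v)) : ℂ))
    (fun u => conj_unipDeltaChar_eq_mul_finprod_off L e dV hdV dW hdW S T u)
    (fun v hv k hk => by
      rw [unipDeltaChar_locToAdelic_eq_one_of_integral L e dV hdV dW hdW S v (hS v hv) k hk, Circle.coe_one, map_one])
    hG

end Summit.HodgeConjecture.HodgeConjecture.Cruxes.HLiu418.K2LiuWhittakerDeltaEulerProduct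

end
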